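import Summits.AtomisticToContinuum.Crystallization.Theorems.ChartedZeroExcessLayeredLatticeLiouvilleO

/-!
# ChartedZeroExcessLayered · LatticeLiouville — part P: §I «RigidChartSoftStack» — on MINIMISERS sup-flatness is OUTPUT, not hypothesis
(the GSC column loses K «no cores»: ONE John leaf H♭^ℓ), and the chart data split RIGID / SOFT: the global affine chart `L` is pinned by
ENERGY (Z_E, GSC-free; `BindingSurface` ⇒ Z_L PROVED) while the per-layer stacking data `w` is pinned only by EQUILIBRIUM (W); erratum on the
tag of g27's Z (decomp-a2c lens-2 generation 28; NEW content, imports part O)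

THE CUT (lens «structural dichotomy», applied twice to the PROOF ARCHITECTURE of the g27 column of record `_16XGc`
= `{LLC, LLC', R_G, X, Z, Z^sup, K_G^c, H_pert,G^c, HBG″}`):

(1) SUP IS OUTPUT.  The pair K_G^c «core exclusion: mean-square-flat ⇒ sup-flat» / H_pert,G^c «sup-flat ⇒ mean-square halves» is the
    architecture forced by the NASH door (critical points: the linearisation is only justified where the configuration sits pointwise inside the
    convexity radius, so a sup bound must be an INPUT of the decay step).  For MINIMISERS the ε-regularity step needs mean-square smallness only —
    the sup / Campanato bound is an OUTPUT of the iterated decay (Evans 1986 / Giaquinta–Modica 1986 quasiconvex partial regularity: Caccioppoli by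
    minimality against a healed competitor, A-harmonic approximation, linear decay; discrete analogue: GSC at equal particle number against the
    chart patch glued in).  So on the GSC door the John-perturbative residual is ONE piece, the one-step halving H♭ «η-flat at `M·R` ⇒ η/2-flat at `R`»,
    WITHOUT a sup clause anywhere: **H♭^ℓ «HalvingBasinPGL»** below.  K «no cores» is not needed on minimisers (it is implied a posteriori and never
    used); the K/H_pert split survives only as the finer alternative (`_16XGℓ`), composed back by the tree's `halvingBasinPG_of_perturbative_core`.

(2) RIGID vs SOFT chart data.  A layered chart `LayeredHom L w` has GLOBAL data `L` (in-plane lattice vectors, hence scale and in-plane strain;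
    its normal column is set-irrelevant) and LOCAL data `w : ℤ → E3` (one translation per layer: gaps and registry).  They are pinned by DIFFERENT
    physics.  `L` is pinned by ENERGY: a wrong in-plane scale / shear costs excess-energy DENSITY `c·d(L)²·R³` on the window, which the comparison bound
    `BindingSurface` (excess `≤ C₁R²`, tree, PROVED) forbids for `R ≥ C/(c d²)` — uniformly, at the exact level `η`, with the tolerance `s` absorbing the
    residual strain.  `w` is NOT pinned by energy: ONE off-ideal layer pair (a gap or registry fault across one plane) costs `~c·g²·R²` ≤ `C₁R²` —
    INVISIBLE to `BindingSurface` — and contributes `O(1/R)` to the mean-square misfit — invisible to η-flatness at large `R`.  Hence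
    ERRATUM (g27 part O, docstring of Z «ConformalLocalisationPG»): its conclusion `NearHomL2BDC` contains `IsCoreStack a s L w` («EVERY layer gap within
    `s` of ideal, every registry within `s·a` of a hollow site»), and that clause is NOT ENERGY-type as claimed there; it is EQUILIBRIUM-type (a planar
    gap/registry fault in a GSC configuration must relax: layer force balance + cleanliness propagate the defect or exclude it) — a different and harder
    mechanism.  This file therefore SPLITS Z into
      Z_L «ConformalChartLocalisationPG»  (conclusion `NearHomL2BDL`: `L` `s`-conformal about `a`, `w` FREE)   ⟸ Z_E ∧ BindingSurface   (PROVED here),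
      W   «StackLocalisationPG»          (`NearHomL2BDL ⇒ NearHomL2BDC` on GSC door sets: the soft data localise)   [EQUILIBRIUM-type, residual only
                                                                                                                     if the John slice below fails],
    and moves the John input of the perturbative pieces from the CORE TUBE (L and w both ideal: TAG 174 (a)) to the L-CORE SLICE: `L` within `s` of
    conformal, `w` ANYWHERE in the clean window (gaps and registries for which the configuration is still `(θ, 1/16)`-two-shell-good) — census ask
    TAG 174 (a‴).  If (a‴) certifies Hessian positivity on the slice, NO localisation of `w` is needed anywhere and the column is `_16XHℓ` (SEVEN leaves);
    if it finds a clean-but-unstable stacking, W is a genuine residual and the column is `_16XHcW` (EIGHT leaves).  Both are PROVED below; the census decides.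

NEW PIECES (all `def … : Prop`, literal instances `(aHi; Λ, θ, s) = (1; 2, 1/16, 1/50)` in the columns):
* `NearHomL2BDL a s Λ κ r S Q` / `NearHomL2SupBDL …` — the RIGID-chart currencies: tree `NearHomL2BD` / part I `NearHomL2SupBD` with `IsConfChart a s L`
  and NOTHING on `w`; seams `BDC ⇒ BDL ⇒ BD` (and sup versions), monotone in the level.
* **Z_E(aHi; Λ, θ, s) «ExcessChartLocalisationP»** — GSC-FREE ENERGY LEAF on EXPLICIT chart data: on a θ-good `aHi`-door set (`IsDoorSetP`, no
  minimality), a root window of radius `R ≥ R_z` with normalised positive excess `≤ ε ≤ ε_z` that is `η`-fitted (`η ≤ η_z`) by the layered chart `(L, w, Ψ, τ)`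
  admits a RE-PRESENTATION `L'` of the same point set (`LayeredHom L' w = LayeredHom L w`, same `w, Ψ, τ`, hence the same misfits and level) that is
  `s`-conformal about `a`.  Content: «normalised excess small ∧ mean misfit small ⇒ the in-plane metric of the fitted chart is within `s` of `a⋆·(isometry)`»
  = the HOMOGENEOUS ENERGY GAP of clean layered states modulo similarities with RELAXED stacking (first lemma (z1ℓ), census TAG 179 (g0ℓ)) + Lipschitz
  dependence of window energy on mean misfit + extension of an in-plane near-isometry to a 3D near-similarity (free normal column).  UNDECIDED · TRUE-type ·
  ENERGY+CERT · ATTACKABLE·M–L · INSTRUMENTABLE (TAG 179).  Why it might fail: two clean in-plane scales with equal minimal energy density beyond the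
  tolerance `s` (for LJ fcc/hcp spacings differ by ~10⁻⁴ ≪ 1/50), or the Lipschitz constant at the clean-tube edge.
* **Z_L / Z_L^sup «ConformalChartLocalisation(Sup)PG»** — g27's Z / Z^sup with conclusion in the rigid-chart currency (no stacking clause).  ⟸ Z_E (PROVED:
  `conformalChartLocalisationPG_of_excess`, `conformalChartLocalisationSupPG_of_excess`, pattern of part N's `scaleExtinctionPG_of_excessControl`:
  `ε := (C₁+1)/R`, floor `max R_z ((C₁+1)/ε_z)`); Z ⇒ Z_L (seam).
* **W / W^sup «StackLocalisation(Sup)PG»** — SOFT-DATA LOCALISATION on GSC door sets: rigid-chart flat ⇒ core-tube flat, same level, every scale `a`.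
  EQUILIBRIUM-type · UNDECIDED · ATTACKABLE·L–XL (layer force balance across a planar fault; cleanliness as a hard constraint) · needed ONLY for the v4-compatible
  columns.  Glue Z ⟸ Z_L ∧ W, Z^sup ⟸ Z_L^sup ∧ W^sup (PROVED).
* **K^ℓ «CoreExclusionPGL», H_pert^ℓ «PerturbativeDecayPGL»** — O's K_G^c / H_pert,G^c with hypothesis currency `NearHomL2BDL` / `NearHomL2SupBDL` (John input on
  the L-core slice).  Seams K_G ⇒ K^ℓ ⇒ K_G^c, H_pert,G ⇒ H_pert^ℓ ⇒ H_pert,G^c; glue K_G ⟸ Z_L ∧ K^ℓ, H_pert,G ⟸ Z_L^sup ∧ H_pert^ℓ (PROVED).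
* ★ **H♭^ℓ(aHi; Λ, θ, s) «HalvingBasinPGL»** — THE ONE JOHN LEAF OF THE MINIMISING DOOR: on θ-good `aHi`-GSC-door sets, for every scale `a > 0` there are a
  basin `κ₀`, a ratio `M` and a floor `R₀` with «`η`-flat at `M·R` under an `s`-conformal chart about `a` (`η ≤ κ₀`, `R ≥ R₀`) ⇒ `η/2`-flat at `R`» — NO sup clause
  in hypothesis or conclusion.  UNDECIDED · TRUE-type · REGULARITY-type (ε-regularity for minimisers of a discrete quasiconvex energy) · ATTACKABLE·L ·
  John input = L-core slice (TAG 174 (a‴)).  Seams H♭_G ⇒ H♭^ℓ ⇒ H♭^c; glue ★ H♭_G ⟸ Z_L ∧ H♭^ℓ (PROVED) and «nothing lost»: H♭_G ⟸ Z_L ∧ Z_L^sup ∧ K^ℓ ∧ H_pert^ℓ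
  (PROVED, via the tree's `halvingBasinPG_of_perturbative_core`).  Why it might fail: a clean-but-linearly-unstable stacking at conformal `L` (then W is needed:
  use H♭^c), or loss of strong compactness in the discrete Caccioppoli step at the clean-tube edge `θ = 1/16`.
* **H♭^c «HalvingBasinPGC»** — the same with core-tube hypothesis (`NearHomL2BDC`), for the W-columns; glue H♭_G ⟸ Z ∧ H♭^c (PROVED).

COLUMNS (PROVED; `VisibleGap (1/50) ∧ PertRegime (1/50)` from opaque leaves + HBG″ = `PeriodicBulkGapDoor 2`):
  ★★★ `_16XHℓ`  SEVEN leaves  `LLC → LLC' → R_G → X → Z_E → H♭^ℓ → HBG″`                       (column of record if TAG 174 (a‴) passes)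
  ★★  `_16XGℓ`  EIGHT leaves  `LLC → LLC' → R_G → X → Z_E → K^ℓ → H_pert^ℓ → HBG″`               (the finer sup-route, rigid-chart John input)
  ★★  `_16XHcW` EIGHT leaves  `LLC → LLC' → R_G → X → Z_E → W → H♭^c → HBG″`                     (column of record if (a‴) fails: soft data must localise)
  ★   `_16XGcW` TEN leaves    `LLC → LLC' → R_G → X → Z_E → W → W^sup → K_G^c → H_pert,G^c → HBG″` (g27 v4's leaves with Z, Z^sup discharged modulo W)
  and the resolved (audit) form of `_16XHℓ` over the six certificate pieces.
DEF-light, no sorry, no instance/notation, axioms standard.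
-/

noncomputable section

open scoped BigOperators InnerProductSpace RealInnerProductSpace
open MeasureTheory Set Metric Filter Topology
open Summit.AtomisticToContinuum.Crystallization.Theorems.ChartedPlanarOrderRigidityDoor
  (E3 IsClean IsNash IsCharted IsEStarGSC VisibleGap PertRegime atomsIn siteEnergy eStar BindingSurface)
open Summit.AtomisticToContinuum.Crystallization.Theorems.ChartedPlanarOrderDensityDichotomy (μS IsSep nK nK_nonneg excess)
open Summit.AtomisticToContinuum.Crystallization.Theorems.ChartedPlanarOrderMesoCut (IsDoorSet NearHom LayeredHom EnvClose)
open Summit.AtomisticToContinuum.Crystallization.Theorems.OverbindingBudgetLiouvilleDictionary (NearHomBD)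
open Summit.AtomisticToContinuum.Crystallization.Theorems.ChartedPlanarOrderDoorLayered
  (TwoPeriodic DoorPeriodic PeriodicBulkGapDoor gap_and_pert_1_50_of_periodic NearHomL2BD nearHomL2BD_mono nearHomBD_of_nearHomL2BD
   sq_le_finsum_mem not_nearHomL2BD_singleton envClose_mono)
open Summit.AtomisticToContinuum.Crystallization.Theorems.ChartedPlanarOrderDoorLayeredOsc (IsTwoShellAffineGood DoorPeriodicOsc)
open Summit.AtomisticToContinuum.Crystallization.Theorems.ChartedPlanarOrderCleanScaleP
  (IsCleanP IsDoorSetP DoorPeriodicP isDoorSetP_mono doorPeriodic_of_doorPeriodicP isDoorSetP_one_iff doorPeriodicP_one_iff)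
open Literature.MathematicalPhysics.StatisticalMechanics (haggLabel barlowOffset layerNormal IsHaggSeq)

namespace Summit.AtomisticToContinuum.Crystallization.Theorems.ChartedZeroExcessLayeredLatticeLiouville

/-! ## §I.1  The RIGID-chart currencies: conformal `L`, free stacking data `w` -/

/-- **`NearHomL2BDL a s Λ κ r S Q`** — `NearHomL2BD Λ κ r S Q` (tree, verbatim) with the chart's GLOBAL datum `L` `s`-conformal about the scale `a`
(`IsConfChart`, part O) and NOTHING imposed on the per-layer translations `w` (gaps / registry free): the rigid-chart currency.  `BDC ⇒ BDL ⇒ BD`. [this file, g28] -/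
def NearHomL2BDL (a s Λ κ r : ℝ) (S Q : Set E3) : Prop :=
  ∃ (L : E3 ≃L[ℝ] E3), ‖(L : E3 →L[ℝ] E3)‖ ≤ Λ ∧ ‖(L.symm : E3 →L[ℝ] E3)‖ ≤ Λ ∧ IsConfChart a s (L : E3 →L[ℝ] E3) ∧
    ∃ (w : ℤ → E3) (Ψ : E3 → E3) (τ : E3 → ℝ), Set.InjOn Ψ Q ∧ Set.MapsTo Ψ Q (LayeredHom (L : E3 →L[ℝ] E3) w) ∧
      (∀ x ∈ Q, 0 ≤ τ x ∧ EnvClose (τ x) r S x (LayeredHom (L : E3 →L[ℝ] E3) w) (Ψ x)) ∧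
      ∑ᶠ x ∈ Q, τ x ^ 2 ≤ κ * nK Q

/-- **`NearHomL2SupBDL a s Λ κ τ₀ r S Q`** — part I's `NearHomL2SupBD Λ κ τ₀ r S Q` with `IsConfChart a s L` and free `w`. [this file, g28] -/
def NearHomL2SupBDL (a s Λ κ τ₀ r : ℝ) (S Q : Set E3) : Prop :=
  ∃ (L : E3 ≃L[ℝ] E3), ‖(L : E3 →L[ℝ] E3)‖ ≤ Λ ∧ ‖(L.symm : E3 →L[ℝ] E3)‖ ≤ Λ ∧ IsConfChart a s (L : E3 →L[ℝ] E3) ∧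
    ∃ (w : ℤ → E3) (Ψ : E3 → E3) (τ : E3 → ℝ), Set.InjOn Ψ Q ∧ Set.MapsTo Ψ Q (LayeredHom (L : E3 →L[ℝ] E3) w) ∧
      (∀ x ∈ Q, 0 ≤ τ x ∧ τ x ≤ τ₀ ∧ EnvClose (τ x) r S x (LayeredHom (L : E3 →L[ℝ] E3) w) (Ψ x)) ∧
      ∑ᶠ x ∈ Q, τ x ^ 2 ≤ κ * nK Q

/-- seam: core-tube flat ⇒ rigid-chart flat (`NearHomL2BDC ⇒ NearHomL2BDL`, forget `IsCoreStack`). [this file, g28] -/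
theorem nearHomL2BDL_of_conf {a s Λ κ r : ℝ} {S Q : Set E3} (h : NearHomL2BDC a s Λ κ r S Q) : NearHomL2BDL a s Λ κ r S Q := by
  obtain ⟨L, hL, hL', hc, w, Ψ, τ, _, hinj, hmaps, hτ, hsum⟩ := h
  exact ⟨L, hL, hL', hc, w, Ψ, τ, hinj, hmaps, hτ, hsum⟩

/-- seam, sup version: `NearHomL2SupBDC ⇒ NearHomL2SupBDL`. [this file, g28] -/
theorem nearHomL2SupBDL_of_conf {a s Λ κ τ₀ r : ℝ} {S Q : Set E3} (h : NearHomL2SupBDC a s Λ κ τ₀ r S Q) : NearHomL2SupBDL a s Λ κ τ₀ r S Q := by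
  obtain ⟨L, hL, hL', hc, w, Ψ, τ, _, hinj, hmaps, hτ, hsum⟩ := h
  exact ⟨L, hL, hL', hc, w, Ψ, τ, hinj, hmaps, hτ, hsum⟩

/-- seam: rigid-chart flat ⇒ flat (`NearHomL2BDL ⇒ NearHomL2BD`, forget `IsConfChart`). [this file, g28] -/
theorem nearHomL2BD_of_confL {a s Λ κ r : ℝ} {S Q : Set E3} (h : NearHomL2BDL a s Λ κ r S Q) : NearHomL2BD Λ κ r S Q := by
  obtain ⟨L, hL, hL', _, w, Ψ, τ, hinj, hmaps, hτ, hsum⟩ := h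
  exact ⟨L, hL, hL', w, Ψ, τ, hinj, hmaps, hτ, hsum⟩

/-- seam, sup version: `NearHomL2SupBDL ⇒ NearHomL2SupBD`. [this file, g28] -/
theorem nearHomL2SupBD_of_confL {a s Λ κ τ₀ r : ℝ} {S Q : Set E3} (h : NearHomL2SupBDL a s Λ κ τ₀ r S Q) : NearHomL2SupBD Λ κ τ₀ r S Q := by
  obtain ⟨L, hL, hL', _, w, Ψ, τ, hinj, hmaps, hτ, hsum⟩ := h
  exact ⟨L, hL, hL', w, Ψ, τ, hinj, hmaps, hτ, hsum⟩

/-- the rigid-chart currency is monotone in the level. [this file, g28] -/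
theorem nearHomL2BDL_mono {a s Λ κ κ' r : ℝ} (hκ : κ ≤ κ') {S Q : Set E3} (h : NearHomL2BDL a s Λ κ r S Q) : NearHomL2BDL a s Λ κ' r S Q := by
  obtain ⟨L, hL, hL', hc, w, Ψ, τ, hinj, hmaps, hτ, hsum⟩ := h
  exact ⟨L, hL, hL', hc, w, Ψ, τ, hinj, hmaps, hτ, hsum.trans (mul_le_mul_of_nonneg_right hκ (nK_nonneg Q))⟩

/-- drop the sup clause inside the rigid-chart currency: `NearHomL2SupBDL ⇒ NearHomL2BDL`. [this file, g28] -/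
theorem nearHomL2BDL_of_supL {a s Λ κ τ₀ r : ℝ} {S Q : Set E3} (h : NearHomL2SupBDL a s Λ κ τ₀ r S Q) : NearHomL2BDL a s Λ κ r S Q := by
  obtain ⟨L, hL, hL', hc, w, Ψ, τ, hinj, hmaps, hτ, hsum⟩ := h
  exact ⟨L, hL, hL', hc, w, Ψ, τ, hinj, hmaps, fun x hx => ⟨(hτ x hx).1, (hτ x hx).2.2⟩, hsum⟩

/-! ## §I.2  Z_E «ExcessChartLocalisation» — the GSC-FREE energy leaf on explicit chart data -/

/-- **Z_E(aHi; Λ, θ, s) «ExcessChartLocalisationP»** — THE RIGID DATUM IS PINNED BY ENERGY (GSC-free; a statement about the energy landscape of clean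
layered windows): for every δ there are a scale `a > 0`, a level ceiling `η_z > 0`, an excess ceiling `ε_z > 0` and a floor `R_z ≥ 1` such that on every
θ-good `aHi`-door set (`IsDoorSetP`: rooted, hard core, clean, charted — NO minimality), every root window of radius `R ≥ R_z` whose positive excess is
`≤ ε·R³` (`0 < ε ≤ ε_z`) and which is fitted at mean-square level `η` (`0 < η ≤ η_z`) by EXPLICIT layered chart data `(L, w, Ψ, τ)` of distortion `≤ Λ`
admits a re-presentation `L'` of the SAME layered point set (`LayeredHom L' w = LayeredHom L w`; same `w`, `Ψ`, `τ`, so the same misfits at the same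
level) with `L'` `s`-CONFORMAL about `a` and distortion `≤ Λ`.  Mechanism: normalised excess `≤ ε` + mean misfit `≤ √η` + Lipschitz dependence of the
window energy on the misfit ⇒ the homogeneous clean state `LayeredHom L w` has energy density `≤ e⋆ + Cε + C√η`; the HOMOGENEOUS ENERGY GAP modulo
similarities with relaxed stacking (first lemma (z1ℓ): `E_hom(L, w) − e⋆ ≥ c·dist(L|plane, a⋆·O)²` for every clean stacking `w`, census TAG 179 (g0ℓ)) then
puts the in-plane metric of `L` within `s` of `a⋆·(isometry)` once `Cε_z + C√η_z ≤ c s²`; the set-irrelevant normal column of `L` is re-chosen to make `L'`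
a 3D near-similarity.  Nothing is claimed about `w` (see W).  UNDECIDED · TRUE-type · ENERGY+CERT · ATTACKABLE·M–L · INSTRUMENTABLE.  Why it might
fail: two clean in-plane scales of equal minimal energy density further apart than `s` (LJ: fcc/hcp differ by ~10⁻⁴ ≪ 1/50), or the Lipschitz constant /
gap constant at the clean-tube edge (`θ = 1/16`) — finite computations. [this file, g28] -/
def ExcessChartLocalisationP (aHi Λ θ s : ℝ) : Prop :=
  ∀ δ : ℝ, 0 < δ → ∃ a : ℝ, 0 < a ∧ ∃ ηz : ℝ, 0 < ηz ∧ ∃ εz : ℝ, 0 < εz ∧ ∃ Rz : ℝ, 1 ≤ Rz ∧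
    ∀ S : Set E3, IsDoorSetP aHi δ S → (∀ q ∈ S, IsTwoShellAffineGood θ S q) →
      ∀ η : ℝ, 0 < η → η ≤ ηz → ∀ R : ℝ, Rz ≤ R → ∀ ε : ℝ, 0 < ε → ε ≤ εz →
        max (excess S (atomsIn (μS S) 0 R)) 0 ≤ ε * R ^ 3 →
        ∀ (L : E3 ≃L[ℝ] E3) (w : ℤ → E3) (Ψ : E3 → E3) (τ : E3 → ℝ),
          ‖(L : E3 →L[ℝ] E3)‖ ≤ Λ → ‖(L.symm : E3 →L[ℝ] E3)‖ ≤ Λ →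
          Set.InjOn Ψ (atomsIn (μS S) 0 R) → Set.MapsTo Ψ (atomsIn (μS S) 0 R) (LayeredHom (L : E3 →L[ℝ] E3) w) →
          (∀ x ∈ atomsIn (μS S) 0 R, 0 ≤ τ x ∧ EnvClose (τ x) 4 S x (LayeredHom (L : E3 →L[ℝ] E3) w) (Ψ x)) →
          ∑ᶠ x ∈ atomsIn (μS S) 0 R, τ x ^ 2 ≤ η * nK (atomsIn (μS S) 0 R) →
          ∃ L' : E3 ≃L[ℝ] E3, ‖(L' : E3 →L[ℝ] E3)‖ ≤ Λ ∧ ‖(L'.symm : E3 →L[ℝ] E3)‖ ≤ Λ ∧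
            IsConfChart a s (L' : E3 →L[ℝ] E3) ∧ LayeredHom (L' : E3 →L[ℝ] E3) w = LayeredHom (L : E3 →L[ℝ] E3) w

/-- Z_E is ANTITONE in the ceiling. [this file, g28] -/
theorem ExcessChartLocalisationP.anti {aHi aHi' Λ θ s : ℝ} (hle : aHi ≤ aHi') (h : ExcessChartLocalisationP aHi' Λ θ s) :
    ExcessChartLocalisationP aHi Λ θ s := by
  intro δ hδ
  obtain ⟨a, ha, ηz, hηz, εz, hεz, Rz, hRz, h'⟩ := h δ hδ
  exact ⟨a, ha, ηz, hηz, εz, hεz, Rz, hRz, fun S hS => h' S (isDoorSetP_mono hle hS)⟩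

/-! ## §I.3  Z_L, Z_L^sup «ConformalChartLocalisation» — the rigid datum localises on GSC door sets (⟸ Z_E, PROVED) -/

/-- **Z_L(aHi; Λ, θ, s) «ConformalChartLocalisationPG»** — part O's Z with conclusion in the RIGID-chart currency: on θ-good `aHi`-GSC-door sets, far-out
root windows that are `η`-flat (`η ≤ η_z`) are `η`-flat under an `s`-conformal chart about `a` — nothing claimed about the stacking data.  ENERGY-type, and
this time honestly so: ⟸ Z_E ∧ `BindingSurface` (`conformalChartLocalisationPG_of_excess`, PROVED).  Z ⇒ Z_L (`conformalChartLocalisationPG_of_Z`). [this file, g28] -/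
def ConformalChartLocalisationPG (aHi Λ θ s : ℝ) : Prop :=
  ∀ δ : ℝ, 0 < δ → ∃ a : ℝ, 0 < a ∧ ∃ ηz : ℝ, 0 < ηz ∧ ∃ Rz : ℝ, 0 < Rz ∧
    ∀ S : Set E3, IsDoorSetPG aHi δ S → (∀ q ∈ S, IsTwoShellAffineGood θ S q) →
      ∀ η : ℝ, 0 < η → η ≤ ηz → ∀ R : ℝ, Rz ≤ R →
        NearHomL2BD Λ η 4 S (atomsIn (μS S) 0 R) → NearHomL2BDL a s Λ η 4 S (atomsIn (μS S) 0 R)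

/-- **Z_L^sup(aHi; Λ, θ, s) «ConformalChartLocalisationSupPG»** — the same in the sup-and-mean-square currency (sup level preserved). ⟸ Z_E (PROVED). [this file, g28] -/
def ConformalChartLocalisationSupPG (aHi Λ θ s : ℝ) : Prop :=
  ∀ δ : ℝ, 0 < δ → ∃ a : ℝ, 0 < a ∧ ∃ ηz : ℝ, 0 < ηz ∧ ∃ Rz : ℝ, 0 < Rz ∧
    ∀ S : Set E3, IsDoorSetPG aHi δ S → (∀ q ∈ S, IsTwoShellAffineGood θ S q) →
      ∀ η : ℝ, 0 < η → η ≤ ηz → ∀ R : ℝ, Rz ≤ R → ∀ τ₀ : ℝ, 0 < τ₀ →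
        NearHomL2SupBD Λ η τ₀ 4 S (atomsIn (μS S) 0 R) → NearHomL2SupBDL a s Λ η τ₀ 4 S (atomsIn (μS S) 0 R)

/-- seam: Z ⇒ Z_L (part O's core-tube localisation implies the rigid-chart one). [this file, g28] -/
theorem conformalChartLocalisationPG_of_Z {aHi Λ θ s : ℝ} (h : ConformalLocalisationPG aHi Λ θ s) : ConformalChartLocalisationPG aHi Λ θ s := by
  intro δ hδ
  obtain ⟨a, ha, ηz, hηz, Rz, hRz, h'⟩ := h δ hδ
  exact ⟨a, ha, ηz, hηz, Rz, hRz, fun S hS hO η hη hηle R hR hflat => nearHomL2BDL_of_conf (h' S hS hO η hη hηle R hR hflat)⟩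

/-- seam: Z^sup ⇒ Z_L^sup. [this file, g28] -/
theorem conformalChartLocalisationSupPG_of_Z {aHi Λ θ s : ℝ} (h : ConformalLocalisationSupPG aHi Λ θ s) :
    ConformalChartLocalisationSupPG aHi Λ θ s := by
  intro δ hδ
  obtain ⟨a, ha, ηz, hηz, Rz, hRz, h'⟩ := h δ hδ
  exact ⟨a, ha, ηz, hηz, Rz, hRz, fun S hS hO η hη hηle R hR τ₀ hτ₀ hflat => nearHomL2SupBDL_of_conf (h' S hS hO η hη hηle R hR τ₀ hτ₀ hflat)⟩

/-- the comparison bound as a NORMALISED-EXCESS bound: on an e⋆-GSC door set the positive part of the window excess is `≤ ((C₁+1)/R)·R³` for `R ≥ 1`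
(part N's bookkeeping, isolated). [this file, g28] -/
theorem max_excess_window_le_of_gsc {δ : ℝ} (hδ : 0 < δ) :
    ∃ C₁ : ℝ, 0 ≤ C₁ ∧ ∀ aHi : ℝ, ∀ S : Set E3, IsDoorSetPG aHi δ S → ∀ R : ℝ, 1 ≤ R →
      max (excess S (atomsIn (μS S) 0 R)) 0 ≤ (C₁ + 1) / R * R ^ 3 := by
  obtain ⟨C₁, hC₁, hB⟩ := excess_window_le_of_gsc hδ
  refine ⟨C₁, hC₁, fun aHi S hS R hR1 => ?_⟩
  have hRpos : 0 < R := one_pos.trans_le hR1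
  have h1 : (C₁ + 1) / R * R ^ 3 = (C₁ + 1) * R ^ 2 := by field_simp
  rw [h1]
  refine max_le ?_ (by positivity)
  have h2 : C₁ * R ^ 2 ≤ (C₁ + 1) * R ^ 2 := by nlinarith [sq_nonneg R]
  exact (hB aHi S hS R hR1).trans h2

/-- ★★ **Z_L ⟸ Z_E (PROVED)** — on MINIMISERS the rigid chart datum localises by ENERGY: `BindingSurface` makes the normalised positive excess of the window of
radius `R` at most `(C₁+1)/R ≤ ε_z` beyond `R ≥ (C₁+1)/ε_z`, and Z_E re-presents the η-fitting chart conformally at the same level. [this file, g28] -/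
theorem conformalChartLocalisationPG_of_excess {aHi Λ θ s : ℝ} (hE : ExcessChartLocalisationP aHi Λ θ s) : ConformalChartLocalisationPG aHi Λ θ s := by
  intro δ hδ
  obtain ⟨a, ha, ηz, hηz, εz, hεz, Rz, hRz, hE'⟩ := hE δ hδ
  obtain ⟨C₁, hC₁, hB⟩ := max_excess_window_le_of_gsc hδ
  refine ⟨a, ha, ηz, hηz, max Rz ((C₁ + 1) / εz), lt_of_lt_of_le one_pos (hRz.trans (le_max_left _ _)),
    fun S hS hO η hη hηle R hR hflat => ?_⟩
  have hRzR : Rz ≤ R := (le_max_left _ _).trans hR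
  have hR1 : 1 ≤ R := hRz.trans hRzR
  have hRpos : 0 < R := one_pos.trans_le hR1
  have hε' : 0 < (C₁ + 1) / R := by positivity
  have hεle : (C₁ + 1) / R ≤ εz := by
    rw [div_le_iff₀ hRpos]
    have h4 : (C₁ + 1) / εz ≤ R := (le_max_right _ _).trans hR
    rw [div_le_iff₀ hεz] at h4
    linarith [h4]
  obtain ⟨L, hL, hL', w, Ψ, τ, hinj, hmaps, hτ, hsum⟩ := hflat
  obtain ⟨L', hM, hM', hconf, hEq⟩ :=
    hE' S hS.1 hO η hη hηle R hRzR ((C₁ + 1) / R) hε' hεle (hB aHi S hS R hR1) L w Ψ τ hL hL' hinj hmaps hτ hsum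
  exact ⟨L', hM, hM', hconf, w, Ψ, τ, hinj, hEq ▸ hmaps, fun x hx => ⟨(hτ x hx).1, hEq ▸ (hτ x hx).2⟩, hsum⟩

/-- ★★ **Z_L^sup ⟸ Z_E (PROVED)** — the same re-presentation keeps the deviation profile, hence the sup level. [this file, g28] -/
theorem conformalChartLocalisationSupPG_of_excess {aHi Λ θ s : ℝ} (hE : ExcessChartLocalisationP aHi Λ θ s) :
    ConformalChartLocalisationSupPG aHi Λ θ s := by
  intro δ hδ
  obtain ⟨a, ha, ηz, hηz, εz, hεz, Rz, hRz, hE'⟩ := hE δ hδ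
  obtain ⟨C₁, hC₁, hB⟩ := max_excess_window_le_of_gsc hδ
  refine ⟨a, ha, ηz, hηz, max Rz ((C₁ + 1) / εz), lt_of_lt_of_le one_pos (hRz.trans (le_max_left _ _)),
    fun S hS hO η hη hηle R hR τ₀ hτ₀ hflat => ?_⟩
  have hRzR : Rz ≤ R := (le_max_left _ _).trans hR
  have hR1 : 1 ≤ R := hRz.trans hRzR
  have hRpos : 0 < R := one_pos.trans_le hR1
  have hε' : 0 < (C₁ + 1) / R := by positivity
  have hεle : (C₁ + 1) / R ≤ εz := by
    rw [div_le_iff₀ hRpos]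
    have h4 : (C₁ + 1) / εz ≤ R := (le_max_right _ _).trans hR
    rw [div_le_iff₀ hεz] at h4
    linarith [h4]
  obtain ⟨L, hL, hL', w, Ψ, τ, hinj, hmaps, hτ, hsum⟩ := hflat
  obtain ⟨L', hM, hM', hconf, hEq⟩ :=
    hE' S hS.1 hO η hη hηle R hRzR ((C₁ + 1) / R) hε' hεle (hB aHi S hS R hR1) L w Ψ τ hL hL' hinj hmaps
      (fun x hx => ⟨(hτ x hx).1, (hτ x hx).2.2⟩) hsum
  exact ⟨L', hM, hM', hconf, w, Ψ, τ, hinj, hEq ▸ hmaps, fun x hx => ⟨(hτ x hx).1, (hτ x hx).2.1, hEq ▸ (hτ x hx).2.2⟩, hsum⟩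

/-! ## §I.4  W, W^sup «StackLocalisation» — the SOFT data (gaps, registry) localise on GSC door sets [EQUILIBRIUM-type] -/

/-- **W(aHi; Λ, θ, s) «StackLocalisationPG»** — SOFT-DATA LOCALISATION: for every δ and every scale `a > 0` there are `η_w > 0`, `R_w > 0` such that on θ-good
`aHi`-GSC-door sets a root window of radius `R ≥ R_w` that is `η`-flat (`η ≤ η_w`) under an `s`-conformal chart about `a` is `η`-flat under a CORE-TUBE chart
(`IsCoreStack`: every layer gap within `s` of ideal, every registry within `s·a` of a hollow site).  EQUILIBRIUM-type, NOT energy-type (erratum to part O):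
a single planar gap/registry fault costs `O(R²) ≤ C₁R²` and `O(1/R)` in mean-square misfit, so neither `BindingSurface` nor flatness sees it; what excludes
it in a GSC configuration is layer force balance + cleanliness as a hard constraint (or it is FALSE, if a clean faulted stacking is itself GSC-compatible —
then the John input must live on the L-core slice and W is moot: column `_16XHℓ`).  UNDECIDED · ATTACKABLE·L–XL.  Needed only by the W-columns. [this file, g28] -/
def StackLocalisationPG (aHi Λ θ s : ℝ) : Prop :=
  ∀ δ : ℝ, 0 < δ → ∀ a : ℝ, 0 < a → ∃ ηw : ℝ, 0 < ηw ∧ ∃ Rw : ℝ, 0 < Rw ∧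
    ∀ S : Set E3, IsDoorSetPG aHi δ S → (∀ q ∈ S, IsTwoShellAffineGood θ S q) →
      ∀ η : ℝ, 0 < η → η ≤ ηw → ∀ R : ℝ, Rw ≤ R →
        NearHomL2BDL a s Λ η 4 S (atomsIn (μS S) 0 R) → NearHomL2BDC a s Λ η 4 S (atomsIn (μS S) 0 R)

/-- **W^sup(aHi; Λ, θ, s) «StackLocalisationSupPG»** — the same in the sup-and-mean-square currency. [this file, g28] -/
def StackLocalisationSupPG (aHi Λ θ s : ℝ) : Prop :=
  ∀ δ : ℝ, 0 < δ → ∀ a : ℝ, 0 < a → ∃ ηw : ℝ, 0 < ηw ∧ ∃ Rw : ℝ, 0 < Rw ∧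
    ∀ S : Set E3, IsDoorSetPG aHi δ S → (∀ q ∈ S, IsTwoShellAffineGood θ S q) →
      ∀ η : ℝ, 0 < η → η ≤ ηw → ∀ R : ℝ, Rw ≤ R → ∀ τ₀ : ℝ, 0 < τ₀ →
        NearHomL2SupBDL a s Λ η τ₀ 4 S (atomsIn (μS S) 0 R) → NearHomL2SupBDC a s Λ η τ₀ 4 S (atomsIn (μS S) 0 R)

/-- ★ **Z ⟸ Z_L ∧ W (PROVED)**: rigid localisation (energy) then soft localisation (equilibrium) give part O's core-tube localisation. [this file, g28] -/
theorem conformalLocalisationPG_of_chart_stack {aHi Λ θ s : ℝ} (hZ : ConformalChartLocalisationPG aHi Λ θ s) (hW : StackLocalisationPG aHi Λ θ s) :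
    ConformalLocalisationPG aHi Λ θ s := by
  intro δ hδ
  obtain ⟨a, ha, ηz, hηz, Rz, hRz, hZ'⟩ := hZ δ hδ
  obtain ⟨ηw, hηw, Rw, hRw, hW'⟩ := hW δ hδ a ha
  refine ⟨a, ha, min ηz ηw, lt_min hηz hηw, max Rz Rw, lt_max_of_lt_left hRz, fun S hS hO η hη hηle R hR hflat => ?_⟩
  exact hW' S hS hO η hη (hηle.trans (min_le_right _ _)) R ((le_max_right _ _).trans hR)
    (hZ' S hS hO η hη (hηle.trans (min_le_left _ _)) R ((le_max_left _ _).trans hR) hflat)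

/-- ★ **Z^sup ⟸ Z_L^sup ∧ W^sup (PROVED)**. [this file, g28] -/
theorem conformalLocalisationSupPG_of_chart_stack {aHi Λ θ s : ℝ} (hZ : ConformalChartLocalisationSupPG aHi Λ θ s)
    (hW : StackLocalisationSupPG aHi Λ θ s) : ConformalLocalisationSupPG aHi Λ θ s := by
  intro δ hδ
  obtain ⟨a, ha, ηz, hηz, Rz, hRz, hZ'⟩ := hZ δ hδ
  obtain ⟨ηw, hηw, Rw, hRw, hW'⟩ := hW δ hδ a ha
  refine ⟨a, ha, min ηz ηw, lt_min hηz hηw, max Rz Rw, lt_max_of_lt_left hRz, fun S hS hO η hη hηle R hR τ₀ hτ₀ hflat => ?_⟩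
  exact hW' S hS hO η hη (hηle.trans (min_le_right _ _)) R ((le_max_right _ _).trans hR) τ₀ hτ₀
    (hZ' S hS hO η hη (hηle.trans (min_le_left _ _)) R ((le_max_left _ _).trans hR) τ₀ hτ₀ hflat)

-- landing note (hand-2 g12): lens-2 g28 (18) part P 781f6b82 (503 l) PRE-SPLIT for the gate's 400-line rule; the remaining sections continue,
-- byte-identical and in the same namespace, in `ChartedZeroExcessLayeredLatticeLiouvillePB`.

end Summit.AtomisticToContinuum.Crystallization.Theorems.ChartedZeroExcessLayeredLatticeLiouville

end
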